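import Literature.NumberTheory.Weil1964.UnitaryArchLocalTopFormHaarWindowAny      -- ★ (A-p06): `archLocalTopFormHaar_univ_eq_lintegral`
import Literature.NumberTheory.Weil1964.UnitaryArchLocalCayleyWeightMassTwo       -- ★ `lintegral_cayleyWeightC_two` (`π³∕2`), `lintegral_cayleyWeightC_one` (`π`)
import Literature.NumberTheory.Weil1964.UnitaryArchLocalSkewCongrDiagonal         -- ★ `skewC_neg`, `exists_conjEquivC_one_of_skewC_eq` (+ ★ `exists_conjEquivC`, `lintegral_cayleyWeightC_eq_of_conj`)
import Literature.LinearAlgebra.Matrix.PosDefHermitianPairDiagonalization         -- ★ `PosDef.exists_eq_mul_conjTranspose` (`H = T Tᴴ`)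
import HarnessLib

/-!
# K2 ∕ E5 «TamagawaUnitary» — FILE `K2E5QuatArchDefiniteMassU` ((19) road (R-def), F3-U): THE `U`-SIDE TOTAL MASSES AT A DEFINITE PLACE
# `μ^TF_w(U(h_w)) = π³∕2` (any definite hermitian `h_w`) and `μ^TF_w(U(1)_w) = π`

Cell `pub/hodgecm-mathlib`, Track B «K2-LIT», engine E5, crux H413 = `stmt-HodgeConjecture-24833`, route `route-HodgeConjecture-HCCMUnconditional`; dealer K2E5-plan (g2)
(RULING 2026-09-04T00:42Z: (19) (H) «=», (R-def) GO); prover seat hodgecm-mathlib-K2E5-p22 (g2).  THEOREMS ONLY; lane `--supports stmt-HodgeConjecture-24833 --as helper`.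

THE MATHEMATICS.  ★ `archLocalTopFormHaar_univ_eq_lintegral` says `μ^TF_w(U(σ_w H)) = ∫_{𝔲(σ_w H)} w₀ dλ` for every `c`-hermitian `H` with unit determinant.  The Lie-algebra
integral is a CONGRUENCE INVARIANT (★ `lintegral_cayleyWeightC_eq_of_conj`, change of variables along `Ad T`), and a positive definite `h_w` is congruent to `1₂`:
`h_w = T Tᴴ = formCongr conj (Tᴴ) 1₂` (★ `PosDef.exists_eq_mul_conjTranspose`); so the mass is ★ `lintegral_cayleyWeightC_two` `= π³∕2`.  A negative definite `h_w` has the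
same Lie algebra as `−h_w` (★ `skewC_neg`), hence the same mass.  For `N = 1`, `H = (1)`: ★ `lintegral_cayleyWeightC_one` `= π`.  With the `U`-pin (★ `ArchLocalDetPin`) and
★ `K2E5HaarPinFibreMass` these two numbers give `ρU(SU(h_w)) = (π³∕2)∕π = π²∕2` (the F4 assembly).
* `lintegral_cayleyWeightC_two_of_posDef` ∕ `_of_negDef` — `∫_{𝔲(H)} w₀ dλ = π³∕2` for `±H` positive definite.
* `archLocalTopFormHaar_two_univ_of_definite` — `archLocalTopFormHaar L 2 Ha w univ = π³∕2` at a definite place.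
* `archLocalTopFormHaar_one_one_univ` — `archLocalTopFormHaar L 1 1 w univ = π`.

HONEST LABEL.  HC_CM is proved only modulo the 7 printed citations (2 remaining named inputs: hLiu418 = `stmt-HodgeConjecture-24832`, h413 = `stmt-HodgeConjecture-24833`)
until rung 0 closes; this file moves no counter.

## References
* [Rogawski1990] J. D. Rogawski, *Automorphic Representations of Unitary Groups in Three Variables*, Ann. of Math. Stud. 123 (1990), §1.7 p. 6.
* [Macdonald1980] I. G. Macdonald, *The volume of a compact Lie group*, Invent. Math. 56 (1980), 93–95.
* [HornJohnson2013] R. A. Horn, C. R. Johnson, *Matrix Analysis*, 2nd ed. (2013), Thm. 7.2.7 ∕ §7.6.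
-/

set_option autoImplicit false
-- the mandated namespace repeats the single-problem summit's segment (`HodgeConjecture.HodgeConjecture`)
set_option linter.dupNamespace false

noncomputable section

open NumberField NumberField.InfinitePlace MeasureTheory MeasureTheory.Measure Matrix Complex Real
open scoped Matrix MatrixGroups ENNReal NNReal ComplexConjugate ComplexOrder
open Literature.NumberTheory.Automorphic Literature.NumberTheory.Automorphic.UnitaryGroup Literature.NumberTheory.Weil1964.UnitaryArchLocalTopForm

namespace Summit.HodgeConjecture.HodgeConjecture.Cruxes.H413.K2E5QuatArchLocal

/-! ## §1 The Lie-algebra mass of a definite rank-2 carrier -/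

/-- **`∫_{𝔲(H)} w₀ dλ = π³∕2` for POSITIVE DEFINITE `H ∈ M₂(ℂ)`**: `H = T Tᴴ = formCongr conj Tᴴ 1₂`, congruence invariance of the integral (★ `lintegral_cayleyWeightC_eq_of_conj`)
and ★ `lintegral_cayleyWeightC_two`. [cite: Macdonald1980, p. 93] [cite: Rogawski1990, §1.7 p. 6] [cite: HornJohnson2013, §7.6] -/
theorem lintegral_cayleyWeightC_two_of_posDef {H : Matrix (Fin 2) (Fin 2) ℂ} (hH : H.PosDef) [MeasurableSpace ↥(skewC 2 H)] [BorelSpace ↥(skewC 2 H)] :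
    ∫⁻ X, ENNReal.ofReal (cayleyWeightC 2 H X) ∂(lieStdLebesgueC 2 H) = ENNReal.ofReal (π ^ 3 / 2) := by
  letI : MeasurableSpace ↥(skewC 2 (1 : Matrix (Fin 2) (Fin 2) ℂ)) := borel _
  haveI : BorelSpace ↥(skewC 2 (1 : Matrix (Fin 2) (Fin 2) ℂ)) := ⟨rfl⟩
  obtain ⟨T, hT, hHT⟩ := Literature.LinearAlgebra.Matrix.PosDef.exists_eq_mul_conjTranspose hH
  have hTH : Tᴴ.det ≠ 0 := by
    rw [Matrix.det_conjTranspose]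
    exact star_ne_zero.2 hT.ne_zero
  set S : GL (Fin 2) ℂ := Matrix.GeneralLinearGroup.mkOfDetNeZero Tᴴ hTH with hS
  have hSval : (S : Matrix (Fin 2) (Fin 2) ℂ) = Tᴴ := rfl
  have hcongr : formCongr (starRingEnd ℂ) S (1 : Matrix (Fin 2) (Fin 2) ℂ) = H := by
    rw [formCongr, hSval, transpose_map_starRingEnd, Matrix.conjTranspose_conjTranspose, Matrix.mul_one, ← hHT]
  obtain ⟨e, he⟩ := exists_conjEquivC (N := 2) (Jw := (1 : Matrix (Fin 2) (Fin 2) ℂ)) (Jw₂ := H) hcongr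
  rw [← lintegral_cayleyWeightC_eq_of_conj e he, lintegral_cayleyWeightC_two rfl]

/-- **`∫_{𝔲(H)} w₀ dλ = π³∕2` for NEGATIVE DEFINITE `H`**: `𝔲(H) = 𝔲(−H)` (★ `skewC_neg`) and the previous lemma for `−H`. [cite: Macdonald1980, p. 93] [cite: Rogawski1990, §1.7 p. 6] -/
theorem lintegral_cayleyWeightC_two_of_negDef {H : Matrix (Fin 2) (Fin 2) ℂ} (hH : (-H).PosDef) [MeasurableSpace ↥(skewC 2 H)] [BorelSpace ↥(skewC 2 H)] :
    ∫⁻ X, ENNReal.ofReal (cayleyWeightC 2 H X) ∂(lieStdLebesgueC 2 H) = ENNReal.ofReal (π ^ 3 / 2) := by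
  letI : MeasurableSpace ↥(skewC 2 (-H)) := borel _
  haveI : BorelSpace ↥(skewC 2 (-H)) := ⟨rfl⟩
  obtain ⟨e, he⟩ := exists_conjEquivC_one_of_skewC_eq (N := 2) (Jw := H) (Jw₂ := -H) (skewC_neg H)
  rw [lintegral_cayleyWeightC_eq_of_conj e he]
  exact lintegral_cayleyWeightC_two_of_posDef hH

/-! ## §2 The per-place top-form masses over the CM field -/

variable (L : Type) [Field L] [NumberField L] [IsCMField L] (Ha : Matrix (Fin 2) (Fin 2) L) (w : {w : InfinitePlace L // IsComplex w})

/-- **`μ^TF_w(U(h_w)) = π³∕2` AT A DEFINITE PLACE**: for `h` hermitian (`(h.map c)ᵀ = h`, the E5 spelling) with `det h ≠ 0` and `h_w = σ_w(h)` positive or negative definite,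
`archLocalTopFormHaar L 2 Ha w univ = π³∕2` (★ `archLocalTopFormHaar_univ_eq_lintegral` + §1). [cite: Rogawski1990, §1.7 p. 6] [cite: Macdonald1980, p. 93] -/
theorem archLocalTopFormHaar_two_univ_of_definite [MeasurableSpace (GL (Fin 2) ℂ)] [BorelSpace (GL (Fin 2) ℂ)]
    (hHa : (Ha.map (cmConjRingHom L)).transpose = Ha) (hdet : Ha.det ≠ 0)
    (hdef : (Ha.map w.1.embedding).PosDef ∨ (-(Ha.map w.1.embedding)).PosDef) :
    archLocalTopFormHaar L 2 Ha w Set.univ = ENNReal.ofReal (π ^ 3 / 2) := by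
  letI : MeasurableSpace ↥(skewC 2 (Ha.map w.1.embedding)) := borel _
  haveI : BorelSpace ↥(skewC 2 (Ha.map w.1.embedding)) := ⟨rfl⟩
  rw [archLocalTopFormHaar_univ_eq_lintegral L 2 Ha hHa (isUnit_iff_ne_zero.2 hdet) w]
  rcases hdef with h | h
  · exact lintegral_cayleyWeightC_two_of_posDef h
  · exact lintegral_cayleyWeightC_two_of_negDef h

omit [NumberField L] [IsCMField L] in
/-- `σ_w(1₁) = 1₁`. [folklore] -/
theorem map_embedding_one_one : (1 : Matrix (Fin 1) (Fin 1) L).map w.1.embedding = 1 :=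
  Matrix.map_one _ (map_zero _) (map_one _)

/-- **`μ^TF_w(U(1)_w) = π`**: `archLocalTopFormHaar L 1 (1) w univ = π` (★ `archLocalTopFormHaar_univ_eq_lintegral` at `N = 1`, `H = (1)` + ★ `lintegral_cayleyWeightC_one`).
[cite: Rogawski1990, §1.7 p. 6] [cite: Macdonald1980, p. 93] -/
theorem archLocalTopFormHaar_one_one_univ [MeasurableSpace (GL (Fin 1) ℂ)] [BorelSpace (GL (Fin 1) ℂ)] :
    archLocalTopFormHaar L 1 (1 : Matrix (Fin 1) (Fin 1) L) w Set.univ = ENNReal.ofReal π := by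
  letI : MeasurableSpace ↥(skewC 1 ((1 : Matrix (Fin 1) (Fin 1) L).map w.1.embedding)) := borel _
  haveI : BorelSpace ↥(skewC 1 ((1 : Matrix (Fin 1) (Fin 1) L).map w.1.embedding)) := ⟨rfl⟩
  have hherm : ((1 : Matrix (Fin 1) (Fin 1) L).map (IsCMField.complexConj L))ᵀ = 1 := by
    rw [Matrix.map_one _ (map_zero _) (map_one _), Matrix.transpose_one]
  have hdet : IsUnit (1 : Matrix (Fin 1) (Fin 1) L).det := by
    rw [Matrix.det_one]
    exact isUnit_one
  rw [archLocalTopFormHaar_univ_eq_lintegral L 1 (1 : Matrix (Fin 1) (Fin 1) L) hherm hdet w]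
  have h1 := map_embedding_one_one L w
  exact lintegral_cayleyWeightC_one (by rw [h1, Matrix.conjTranspose_one]) (by rw [h1, Matrix.det_one]; exact isUnit_one)

end Summit.HodgeConjecture.HodgeConjecture.Cruxes.H413.K2E5QuatArchLocal

end
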